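import Literature.MathematicalPhysics.QuantumFieldTheory.Balaban1983to89.B9Eq3105FamThreeLocDiffG
import Literature.MathematicalPhysics.QuantumFieldTheory.Balaban1983to89.B9Cor36GpCubeEntriesAtV
import Literature.MathematicalPhysics.QuantumFieldTheory.Balaban1983to89.B9ThmDCommutatorStep

/-!
# `Balaban1983to89.B9Eq3105FamThreeCommStepAtDatum` — FAMILY 3 OF (3.105): THE TWO CUBE-SIDE INPUTS OF THE `hDL`∕`hDR` SUPPLIERS AT THE (3.35) DATUM —
# `IsUnit Δ′_{a,□}(Ṽ_□^{u⁻¹})` (`hV □`) and p21 D3's cube-carrier majorant `conj b(R_χ(Ṽ_□)^ℝ) ≺ θ_R·e^{−δ_Rd_□}` (`hR □`) — PACKAGED over all members above one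
# threshold and all cubes, from Cor. 3.6's localised-field letters (`B9Cor36GpCubeEntriesAtV.gp_cube_entries_at_locCfg`, `B9Cor36GpCubeExtAtV.gp_cube_at_locCfg`) and
# D3 (`B9ThmDCommutatorStep.hasMajorant_conj_commStep`) BY NAME, exactly as p21's D6 `B9ThmDAtDatum` does internally (sub-row G-B9-LETTERS, GAPS G-B9-p33-01,
# programme FAMTHREE FILE F3-E2e; design `lit-balaban-p33/g103/F3E-SCOPE.md`)

statement-level skeleton of published theorems with citation tags; proofs where landed; nothing here is a claim about the Yang–Mills mass gap

THE PRINTED LOCUS (verbatim, held `paper:balaban1985-cmp99-background-propagators`, journal page = PDF page + 388).  (3.88)–(3.89) p. 409 (the commutator letter, «give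
small factors O(M⁻¹)» p. 412); Cor. 3.6 p. 408 («U′ = U^u = e^{iηA}», the localised field); Thm 3.1 (3.42) p. 397; Thm 3.4 p. 400; (3.24)–(3.25) p. 394; (3.31)–(3.33)
pp. 395–396; (3.59) p. 402; [4] (2.51)–(2.52) p. 232, p. 247.

WHAT THIS FILE CERTIFIES (kernel-checked; 0 `def`, 0 `def … : Prop`, 0 sorry; standard axioms only)

* §1 `isUnit_conjY`, ★ `isUnit_deltaPrimeACubeY_gauge_inv` — `IsUnit Δ′_{a,□}(V) → IsUnit Δ′_{a,□}(V^{g⁻¹})` (`Δ′_{a,□}(V^{g⁻¹}) = R(g)⁻¹Δ′_{a,□}(V)R(g)`, F3-E1).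
* §2 ★★ `commStep_at_datum` — ∃ `δ_R > 0`, `θ_R ≥ 0`, thresholds `M₀, T₀, N₀` and Thm 3.4's `a₁ > 0` (functions of `d, L`, the basis datum) such that for every member above
  the thresholds, every cover cube `□`, all letters `Rr, H`, every gauge `g`, field `U` and (3.35) cube datum `(A, Q, C, ξ, Λ)` with `α₁ = max C (C(1+D₁θ))Λ² ≤ a₁, 1∕4`:
  `IsUnit Δ′_{a,□}(Ṽ_□)` and `conj b(((M_{χ_□}Δ′_{a,□}(Ṽ_□) − Δ′_{a,□}(Ṽ_□)M_{χ_□})·G′_□(Ṽ_□))^ℝ) ≺ θ_R·e^{−δ_Rd_□}` over `(toB6 (geoCK i □) Rr H, blkCubeY)`,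
  `Ṽ_□ = locCfgY i □ η_k A` — F3-E2d's `hR □` and (with §1) `hV □`.

HONEST SCOPE ∕ NOT CLAIMED.  A repackaging of landed results (p33 7b-C's cube packages + p21 D3) for the family-3 consumers; no new inequality.  `𝔸` with `‖1‖ = 1`.
Count-neutral; NOT a node discharge; no summit ∕ sub-problem statement is proved; nothing continuum ∕ OS ∕ mass-gap ∕ Clay; YM mass gap NOT proved (Track A
conditional rung).  No `sorry`, no `axiom`, no `… : Prop` fact, no `instance`, no `notation`, no `def`.  NEW file; nothing landed is modified.  Cell `lit-balaban`,
seat `lit-balaban-p33` gen 103, 2026-08-29; `--supports stmt-QuantumFields-19200` as helper.  Net new unproved facts: 0.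

RELATED IN THE TREE, NOT DUPLICATED (searched 2026-08-29: `rg 'commStep_at_datum|isUnit_deltaPrimeACubeY_gauge' Literature/` = ∅): p21 D6 `B9ThmDAtDatum.thmD_at_datum` derives the
same `hR` INSIDE its proof (not exported); `B9Cor36GpCubeEntriesAtV`, `B9Cor36GpCubeExtAtV`, `B9ThmDCommutatorStep`, F3-E1 — USED BY NAME.
-/

noncomputable section

namespace Literature.MathematicalPhysics.QuantumFieldTheory.Balaban1983to89.B9Eq3105FamThreeCommStepAtDatum

open NormedSpace Complex
open B6RandomWalk (HasMajorant hasMajorant_mono c1_nonneg)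
open B9Thm34Ext (toB6)
open B9Eq352DivFormLetters (conj)
open B9Eq39Adjoint (fluct covD)
open B9Eq360DeltaPrimeAY (AfldY)
open B9Eq360DeltaPrimeACubeY (blkCubeY)
open B6KLevelCensusIndexV1 (KIdx kGeo)
open B6Cover236MultiLevelBlocks (cubes)
open B6GlobalChartV1 (PV boxEquiv)
open B9BackgroundsKLevelV1 (shiftsV1)
open B9CubeGeometryInputs (geoCK RM1)
open B9CubeLettersOpsL0 (deltaPrimeACubeY GpCubeY)
open B9Eq359CubeKernelsAtOne (Cq Cq_nonneg)
open B9Cor36CubeCutoffs (SC NearC chiY locCfgY)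
open B9Cor36GpCubeLocLetter (conjY_inv_mul_conjY conjY_mul_conjY_inv)
open B9Cor36GpCubeExtAtV (GpVK gp_cube_at_locCfg)
open B9Cor36GpCubeEntriesAtV (gp_cube_entries_at_locCfg)
open B9Thm37CubeCoverCommutators (cutMulY)
open B9ThmDCommutatorStep (hasMajorant_conj_commStep)
open B9Eq3105FamThreeLocDiffG (deltaPrimeACubeY_gauge_inv_eq)
open B4PartitionUnity22 (thetaProf D1 D2 D1_nonneg D2_nonneg contDiff_thetaProf hasCompactSupport_thetaProf)
open Node00 (SiteY CfgY GaugeY SiteParY toKT parSymY gaugeY gSiteY conjY IsGaugeLawS parSymY_one)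

variable {d ℓ : ℕ} {hd : 1 ≤ d + 1} {hL : Odd (ℓ + 1) ∧ 1 < ℓ + 1} {b₀ b₁ : ℝ}
variable {𝔸 : Type} [NormedRing 𝔸] [NormedAlgebra ℂ 𝔸] [CompleteSpace 𝔸]
variable {ι : Type} [Fintype ι]

/-! ## §1  `IsUnit Δ′_{a,□}` is gauge-invariant -/

section Unit

variable (i : KIdx d ℓ hd hL b₀ b₁) (c : ↥(cubes (toKT i).D.toDomains))

omit [CompleteSpace 𝔸] in
/-- `R(γ)` is a unit of the site algebra (inverse `R(γ)⁻¹`). [cite: Balaban1985BackgroundPropagators, (3.31) p.395, bookkeeping] -/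
theorem isUnit_conjY (γ : SiteY i → 𝔸ˣ) : IsUnit (conjY γ : Module.End ℂ (SiteY i → 𝔸)) :=
  ⟨⟨conjY γ, conjY γ⁻¹, conjY_mul_conjY_inv i γ, conjY_inv_mul_conjY i γ⟩, rfl⟩

omit [CompleteSpace 𝔸] in
/-- and so is `R(γ)⁻¹`. [cite: Balaban1985BackgroundPropagators, (3.31) p.395, bookkeeping] -/
theorem isUnit_conjY_inv (γ : SiteY i → 𝔸ˣ) : IsUnit (conjY γ⁻¹ : Module.End ℂ (SiteY i → 𝔸)) :=
  ⟨⟨conjY γ⁻¹, conjY γ, conjY_inv_mul_conjY i γ, conjY_mul_conjY_inv i γ⟩, rfl⟩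

/-- ★ **`IsUnit Δ′_{a,□}(V) → IsUnit Δ′_{a,□}(V^{g⁻¹})`** (`Δ′_{a,□}(V^{g⁻¹}) = R(g)⁻¹·Δ′_{a,□}(V)·R(g)`): F3-E2d's `hV □` from the package's unit clause.
[cite: Balaban1985BackgroundPropagators, (3.31)–(3.33) pp.395–396, Cor. 3.6 p.408, p.409 l.3–5] -/
theorem isUnit_deltaPrimeACubeY_gauge_inv {parS : SiteParY 𝔸 i} (hS : IsGaugeLawS i parS) (g : GaugeY 𝔸 i) {V : CfgY 𝔸 i}
    (h : IsUnit (deltaPrimeACubeY i c parS V)) : IsUnit (deltaPrimeACubeY i c parS (gaugeY i g⁻¹ V)) := by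
  rw [deltaPrimeACubeY_gauge_inv_eq i c hS g V]
  exact ((isUnit_conjY_inv i (gSiteY i g)).mul h).mul (isUnit_conjY i (gSiteY i g))

end Unit

/-! ## §2  p21 D3's commutator-letter majorant at the (3.35) datum, packaged -/

section Datum

variable [NormOneClass 𝔸] [DecidableEq ι] (b : Module.Basis ι ℝ 𝔸)

set_option maxHeartbeats 1600000 in
/-- ★★ **THE COMMUTATOR LETTER AT THE DATUM** (F3-E2d's `hR □` and `hV □`'s unit clause): ∃ `δ_R > 0`, `θ_R ≥ 0`, thresholds and `a₁ > 0` such that for every member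
above the thresholds, every cube `□`, all `Rr, H`, every `g, U` and (3.35) datum `(A, Q, C, ξ, Λ)` with `α₁ ≤ a₁, 1∕4`: `IsUnit Δ′_{a,□}(Ṽ_□)` and
`conj b(((M_{χ_□}Δ′_{a,□}(Ṽ_□) − Δ′_{a,□}(Ṽ_□)M_{χ_□})·G′_□(Ṽ_□))^ℝ) ≺ θ_R·e^{−δ_Rd_□}` over `(toB6 (geoCK i □) Rr H, blkCubeY)`, `Ṽ_□ = locCfgY i □ η_k A`
(`θ_R = M₂Σ‖b_j‖·((d+1)B_f(D₁θ∕2 + 3D₂θ∕16) + 1 + B_f + (1 + C_q∕4)²B_f)`, p21 D6's constant).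
[cite: Balaban1985BackgroundPropagators, (3.88)–(3.89) p.409, Cor. 3.6 p.408, Thm 3.1 (3.42) p.397, Thm 3.4 p.400, (3.24)–(3.25) p.394, (3.59) p.402; Balaban1984PropagatorsII, (2.51)–(2.52) p.232, p.247] -/
theorem commStep_at_datum (d ℓ : ℕ) (hℓ : 1 ≤ ℓ) {M₂ : ℝ} (hM₂ : 0 ≤ M₂) (hrepr : ∀ (v : 𝔸) (j : ι), |b.repr v j| ≤ M₂ * ‖v‖) :
    ∃ δR θR M₀ T₀ : ℝ, ∃ N₀ : ℕ, 0 < δR ∧ 0 ≤ θR ∧ ∃ a₁ : ℝ, 0 < a₁ ∧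
    ∀ {hd : 1 ≤ d + 1} {hL : Odd (ℓ + 1) ∧ 1 < ℓ + 1} {b₀ b₁ : ℝ} (i : KIdx d ℓ hd hL b₀ b₁) (c : ↥(cubes (toKT i).D.toDomains)) (Rr : ℝ) (H : Prop),
      M₀ ≤ ((ℓ : ℝ) + 1) * (toKT i).Mh → N₀ + 1 ≤ (toKT i).R * ((ℓ + 1) * (toKT i).Mh) → T₀ ≤ RM1 i →
    ∀ (g : GaugeY 𝔸 i) (U : CfgY 𝔸 i) (A : AfldY 𝔸 i) (Q : Set (Site (PV d ℓ i.m i.K hd hL) 0)) (C ξ Λ : ℝ),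
      0 ≤ C → 0 < ξ → 1 ≤ Λ → ξ ≤ 5 * (SC i c : ℝ) * (kGeo i).eta → LatticeNorms.scaleLen ((ℓ : ℝ) + 1) (kGeo i).eta (c.1.1 + 1) ≤ Λ * ξ →
      (∀ x : Site (PV d ℓ i.m i.K hd hL) 0, NearC i c (35 * SC i c / 8 + 1) (boxEquiv i.hN x).1 → x ∈ Q) →
      (∀ (κ : Fin (d + 1)) (x : Site (PV d ℓ i.m i.K hd hL) 0), x ∈ Q → x.shift κ ∈ Q → gaugeY i g U κ x = fluct (kGeo i).eta A κ x) →
      (∀ κ, ∀ x ∈ Q, ‖A κ x‖ ≤ C * ξ⁻¹) →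
      (∀ μ ν, ∀ x ∈ Q, ‖(((kGeo i).eta : ℂ)⁻¹) • covD (shiftsV1 (PV d ℓ i.m i.K hd hL)) (fun _ _ => (1 : 𝔸ˣ)) μ (A ν) x‖ ≤ C * (ξ ^ 2)⁻¹) →
      max C (C * (1 + D1 thetaProf)) * Λ ^ 2 ≤ a₁ → max C (C * (1 + D1 thetaProf)) * Λ ^ 2 ≤ 1 / 4 →
      IsUnit (deltaPrimeACubeY i c (parSymY i) (locCfgY i c (kGeo i).eta A)) ∧
      HasMajorant (g := toB6 (geoCK i c) Rr H) (fun p : SiteY i × ι => blkCubeY i c p.1)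
        (conj b (((cutMulY (𝔸 := 𝔸) (chiY i c) * deltaPrimeACubeY i c (parSymY i) (locCfgY i c (kGeo i).eta A) -
            deltaPrimeACubeY i c (parSymY i) (locCfgY i c (kGeo i).eta A) * cutMulY (𝔸 := 𝔸) (chiY i c)) *
          GpCubeY i c (parSymY i) (locCfgY i c (kGeo i).eta A)).restrictScalars ℝ))
        (fun a a' => θR * Real.exp (-(δR * (geoCK i c).dist a a'))) := by
  have h1A : ‖(1 : 𝔸)‖ ≤ 1 := norm_one.le
  have hD1 := D1_nonneg contDiff_thetaProf hasCompactSupport_thetaProf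
  have hD2 := D2_nonneg contDiff_thetaProf hasCompactSupport_thetaProf
  have hSb : 0 ≤ ∑ j, ‖b j‖ := Finset.sum_nonneg fun _ _ => norm_nonneg _
  have hMS : 0 ≤ M₂ * ∑ j, ‖b j‖ := mul_nonneg hM₂ hSb
  -- the two cube packages (p33 7b-C and its base)
  obtain ⟨δe, Bf, M₀e, T₀e, N₀e, hδe, hBf, a₁e, ha₁e, HE⟩ := gp_cube_entries_at_locCfg b d ℓ hℓ M₂ hM₂ hrepr
  obtain ⟨δx, BGx, M₀x, T₀x, N₀x, hδx, hBGx, a₁x, ha₁x, Bx, hBx, HX⟩ := gp_cube_at_locCfg b d ℓ hℓ M₂ hM₂ hrepr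
  -- p21 D6's uniform constant
  set θR : ℝ := M₂ * (∑ j, ‖b j‖) * (((d : ℝ) + 1) * Bf * (D1 thetaProf / 2 + 3 * D2 thetaProf / 16) + 1 + Bf * 1 + (1 + Cq d * (1 / 4)) ^ 2 * Bf) with hθRdef
  have hθR : 0 ≤ θR := by rw [hθRdef]; have := Cq_nonneg d; positivity
  refine ⟨δe, θR, max M₀e M₀x, max T₀e T₀x, max N₀e N₀x, hδe, hθR, min a₁e a₁x, lt_min ha₁e ha₁x, ?_⟩
  intro hd hL b₀ b₁ i c Rr H hM hN hT g U A Q C ξ Λ hC0 hξ hΛ hξS hΛξ hQ hgA hAf hdA hα₁ hα4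
  have hMe : M₀e ≤ ((ℓ : ℝ) + 1) * (toKT i).Mh := (le_max_left _ _).trans hM
  have hMx : M₀x ≤ ((ℓ : ℝ) + 1) * (toKT i).Mh := (le_max_right _ _).trans hM
  have hTe : T₀e ≤ RM1 i := (le_max_left _ _).trans hT
  have hTx : T₀x ≤ RM1 i := (le_max_right _ _).trans hT
  have hNe : N₀e + 1 ≤ (toKT i).R * ((ℓ + 1) * (toKT i).Mh) := le_trans (Nat.succ_le_succ (le_max_left _ _)) hN
  have hNx : N₀x + 1 ≤ (toKT i).R * ((ℓ + 1) * (toKT i).Mh) := le_trans (Nat.succ_le_succ (le_max_right _ _)) hN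
  have hα₁0 : 0 ≤ max C (C * (1 + D1 thetaProf)) * Λ ^ 2 := mul_nonneg (le_max_of_le_left hC0) (sq_nonneg _)
  -- the packages at this member ∕ cube
  obtain ⟨hunit, hGV, hDk, -, hLG⟩ := HE i c Rr H hMe hNe hTe g U A Q C ξ Λ hC0 hξ hΛ hξS hΛξ hQ hgA hAf hdA (hα₁.trans (min_le_left _ _)) hα4
  obtain ⟨-, -, -, ⟨-, -, hkF, hsF⟩, -, -⟩ := HX i c Rr H hMx hNx hTx g U A Q C ξ Λ hC0 hξ hΛ hξS hΛξ hQ hgA hAf hdA (hα₁.trans (min_le_right _ _)) hα4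
  refine ⟨hunit, ?_⟩
  -- D3: the commutator step, then the uniform constant `θ_R`
  have hR₀ := hasMajorant_conj_commStep i c b hM₂ hrepr h1A Rr H (parSymY i) (fun z w => parSymY_one i z w) (locCfgY i c (kGeo i).eta A) hunit hBf
    (Cq_nonneg d) hα₁0 hkF hsF hGV (fun μ => hDk (Sum.inl μ)) (fun μ => hDk (Sum.inr μ)) hLG
  refine hasMajorant_mono (g := toB6 (geoCK i c) Rr H) _ hR₀ fun a a' => mul_le_mul_of_nonneg_right ?_ (Real.exp_nonneg _)
  rw [hθRdef]
  set Cqd : ℝ := Cq d with hCqd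
  set α₁ : ℝ := max C (C * (1 + D1 thetaProf)) * Λ ^ 2 with hα₁def
  have hCq : 0 ≤ Cqd := Cq_nonneg d
  have h0 : 0 ≤ 1 + Cqd * α₁ := add_nonneg zero_le_one (mul_nonneg hCq hα₁0)
  have h1 : 1 + Cqd * α₁ ≤ 1 + Cqd * (1 / 4) := by have := mul_le_mul_of_nonneg_left hα4 hCq; linarith only [this]
  have hsq : (1 + Cqd * α₁) ^ 2 ≤ (1 + Cqd * (1 / 4)) ^ 2 := pow_le_pow_left₀ h0 h1 2
  have h3 : (1 + Cqd * α₁) ^ 2 * Bf ≤ (1 + Cqd * (1 / 4)) ^ 2 * Bf := mul_le_mul_of_nonneg_right hsq hBf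
  refine mul_le_mul_of_nonneg_left ?_ hMS
  linarith only [h3]

end Datum

end Literature.MathematicalPhysics.QuantumFieldTheory.Balaban1983to89.B9Eq3105FamThreeCommStepAtDatum

end
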